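import Literature.AlgebraicGeometry.ComplexMultiplication.QuadraticSubfieldFibres
import Literature.AlgebraicGeometry.ComplexMultiplication.QuadraticCMFieldTwoSlotFamilies
import Literature.NumberTheory.ComplexMultiplication.CMTypeRankCommonConstituent
import Literature.AlgebraicGeometry.ComplexMultiplication.SmallIntersectionCMFieldsHodge
import Literature.AlgebraicGeometry.ComplexMultiplication.AbelianVarietyDomination
import Literature.NumberTheory.ComplexMultiplication.CMTypeRankForeignQuadraticSlot
import Literature.NumberTheory.ComplexMultiplication.SharedImaginaryQuadraticFamilies
import Literature.AlgebraicGeometry.Pohlmann1968.NondegenerateCMTypeDivisorGenerated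
import HarnessLib

/-!
# CM elliptic curves against one more CM field: the Weil-fibre exceptional class for `k ↪ K` (Moonen–Zarhin 1999 Thm. 0.2
# (a), (1)), the pairwise "no common constituent" criterion (Gordon 1999 §3, 10.10), and the exact criterion "a shared
# imaginary quadratic field is the only obstruction" for families of curves and one nondegenerate CM field

(Part 1) For a separating family of CM realisations with a curve slot `j₀` (`[K:ℚ] = 2`) and a threefold slot `j₁`
(`[K:ℚ] = 6`) linked by `e : K_{π j₀} ↪ K_{π j₁}`, the WEIL FIBRE weight `{(j₀, ψ₀)} ⊔ {(j₁, s) | s ∘ e = ψ}` is Galois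
balanced but not a disjoint union of balanced pairs, so `D² ≠ B²` on every product containing both slots
(`exists_exceptional_two_prod_of_ringHom`; the tree's `QuadraticSubfieldFibres.WeilFibre` counts); (Part 2) on a two-element
slot every element of `U(Φ_i)` is a `χ_i`-eigenvector and a `χ`-eigenvector vanishes unless `χ = χ_i`; the PAIRWISE
CRITERION: if for all `i ≠ j` the Galois modules `U(Φ_i)`, `U(Φ_j)` have no common constituent, the family is nondegenerate
iff every member is (`isNondegenerateFamily_iff_forall_of_pairwise`); distinct quadratic slots of a separating family have
different sign characters; (Part 3) a FOREIGN imaginary quadratic slot (`K_a ↪̸ K_b`) has no common constituent with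
`U(Φ_b)`, (□) forces foreignness, the "third menu" (quadratic slots pairwise distinguished and foreign to every other field,
pairwise partial conjugations inside the block) and the exact criteria `isNondegenerateFamily_iff_forall_isEmpty` /
`…_single`: for curves and ONE more CM field `K_b`, the family is nondegenerate iff `Φ_b` is and no `K_a` embeds in `K_b`.

* Part 1 — from `CorCM/CMEllipticCurveTimesSimpleCMThreefoldWeilClass` (5/8 declarations; namespace
  `Literature.AlgebraicGeometry.ComplexMultiplication`): The Weil classes of `k` on `E × T` itself: an embedding `k ↪
  K` puts an exceptional rational `(2,2)`-class on the. Declarations: `slot_ne_of_finrank`,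
  `weilFibre_mem_pohlmannSetsAlg_two`, `weilFibre_not_mem_pohlmannDivisorSetsAlg`,
  `exists_mem_pohlmannSetsAlg_two_diff_of_ringHom`, `exists_exceptional_two_prod_of_ringHom`.
* Part 2 — from `CorCM/PairwiseCMFamiliesHodge` (5/14 declarations; namespace
  `Literature.AlgebraicGeometry.ComplexMultiplication.PairwiseCC`): Products of CM elliptic curves and SEVERAL CM
  abelian varieties under PAIRWISE conditions: the "no common. Declarations: `comp_smul_eq_slotSign_smul`,
  `eq_zero_of_eigen_of_card_eq_two`, `card_sigma_ringHom_eq_sum''`, `isNondegenerateFamily_iff_forall_of_pairwise`,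
  `exists_not_iff_of_isSeparatingFamily`.
* Part 3 — from `CorCM/ForeignQuadraticCMFieldsHodge` (8/15 declarations; namespace
  `Literature.AlgebraicGeometry.ComplexMultiplication`): FOREIGN imaginary quadratic fields: CM elliptic curves `E_j`
  whose fields do NOT embed in the CM fields `K_b` of. Declarations: `eq_zero_of_eigen_of_isEmpty`,
  `pairwise_of_isEmpty`, `isEmpty_ringHom_of_smul_smul`, `pairwise_of_menu₃`, `isNondegenerateFamily_iff_of_menu₃`,
  `isSeparatingFamily_subtype`, `isNondegenerateFamily_iff_forall_isEmpty`,
  `isNondegenerateFamily_iff_forall_isEmpty_single`.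

## References

* [MoonenZarhin1999LowDim] B. Moonen, Yu. Zarhin, Math. Ann. 315 (1999) 711–733, Thm. (0.2) (a) and (1) ("in the cases
  (a), (b) and (c) the Weil classes are really needed … `D²(X) ≠ B²(X)`"), (1.9), Criterion 13 of [MZ Duke 1995].
* [Gordon1999HodgeAVSurvey] B. B. Gordon, *A survey of the Hodge conjecture for abelian varieties*, §9.2
  (9.2.1)–9.2.2.
* [Deligne1982HodgeCycles] P. Deligne, LNM 900, §4 (Weil classes), Prop. 4.4.
* [Ribet1980] K. Ribet, *Division fields of abelian varieties with complex multiplication*, §3 (3.7).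
* [Shimura1998] G. Shimura, *Abelian Varieties with Complex Multiplication and Modular Functions*, §8.2 Prop. 26.

Provenance: Literature home of the used declarations of the Summits-side modules listed part by part above (cells
`pub-hodge-ring2` / `pub-hodgecm2`; namespaces `Summit.HodgeConjecture.CorCM`,
`Summit.HodgeConjecture.CorCM.PairwiseCC` re-rooted under `Literature.AlgebraicGeometry.…` as stated), whose imports
are `Literature/` and Mathlib only for the declarations used; re-homed verbatim (proofs unchanged) so that Literature
users are served without importing `Summits/`. Lane `lit-hodgefound`, seat p20 (generation 34). Theorems only: no
definition, no named fact, no `sorry`; axioms `propext`, `Classical.choice`, `Quot.sound`.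
-/

/-! ## Part 1: CMEllipticCurveTimesSimpleCMThreefoldWeilClass -/

noncomputable section

open _root_.CategoryTheory _root_.CategoryTheory.Limits NumberField NumberField.ComplexEmbedding
open scoped BigOperators

namespace Literature.AlgebraicGeometry.ComplexMultiplication

open Literature.AlgebraicGeometry.ComplexMultiplication.QuadraticSubfieldFibres

open Literature.NumberTheory.ComplexMultiplication
open Literature.AlgebraicGeometry.Motives (AbelianVariety CMType)
open Literature.AlgebraicGeometry.HodgeTheory
open Literature.AlgebraicGeometry.ComplexMultiplication (IsCMTypeRealisation)
open Literature.AlgebraicGeometry.Pohlmann1968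
open Literature.Barriers.HodgeConjecture (divisorClassesSpan)

/-! ## §2 The Weil fibre weight on a product `⨁_{j<N} A_{π j}` -/

section Weight

open scoped Classical

variable {I : Type} {K : I → Type} [∀ i, Field (K i)] [∀ i, NumberField (K i)] [∀ i, IsCMField (K i)]
  {Φ : ∀ i, CMType (K i)} {N : ℕ}

omit [∀ i, IsCMField (K i)] in
/-- A curve slot and a threefold slot are different slots. [cite: MoonenZarhin1999LowDim, Thm. (0.2) (a) and (1)] -/
private theorem slot_ne_of_finrank (π : Fin N → I) {j₀ j₁ : Fin N} (h2 : Module.finrank ℚ (K (π j₀)) = 2)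
    (h6 : Module.finrank ℚ (K (π j₁)) = 6) : π j₁ ≠ π j₀ := by
  intro h
  have := congrArg (fun i => Module.finrank ℚ (K i)) h
  simp only [h2, h6] at this
  omega

/-- **The Weil fibre weight is Galois balanced** (`S = {(j₀, ψ₀)} ⊔ {(j₁, s) | s ∘ e = ψ}` with `ψ₀ ∈ Φ_{π j₀}` and
`n(ψ) = #{s ∈ Φ_{π j₁} | s ∘ e = ψ} = 1` lies in `pohlmannSetsAlg 2`): `|S| = 4`, and for `τ ∈ Aut(ℂ)` either `τ`
fixes `Hom(k, ℂ)` — then `#{x ∈ S | τx ∈ Φ} = [ψ₀ ∈ Φ] + n(ψ) = 2` — or `τ` is conjugation there — then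
`#{x ∈ S | τx ∈ Φ} = [ψ̄₀ ∈ Φ] + n(ψ̄) = 0 + 2`: the index of a generator of the Weil plane of `k` acting on `E × T`
with multiplicities `(2, 2)`. [cite: MoonenZarhin1999LowDim, Thm. (0.2) (a) and (1.9)] [cite: Gordon1999HodgeAVSurvey, §9.2 (9.2.1)] -/
theorem weilFibre_mem_pohlmannSetsAlg_two (π : Fin N → I) {j₀ j₁ : Fin N} (h2 : Module.finrank ℚ (K (π j₀)) = 2)
    (h6 : Module.finrank ℚ (K (π j₁)) = 6) (e : K (π j₀) →+* K (π j₁)) {ψ₀ : K (π j₀) →+* ℂ}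
    (hψ₀ : ψ₀ ∈ (Φ (π j₀)).1) {ψ : K (π j₀) →+* ℂ}
    (hn : (Finset.univ.filter fun s : K (π j₁) →+* ℂ => s.comp e = ψ ∧ s ∈ (Φ (π j₁)).1).card = 1) :
    insert (⟨j₀, ψ₀⟩ : (j : Fin N) × (K (π j) →+* ℂ))
        ((Finset.univ.filter fun s : K (π j₁) →+* ℂ => s.comp e = ψ).map ⟨Sigma.mk j₁, sigma_mk_injective⟩) ∈
      pohlmannSetsAlg (K := fun j : Fin N => K (π j)) (fun j => Φ (π j)) 2 := by
  set T : Finset ((j : Fin N) × (K (π j) →+* ℂ)) :=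
    (Finset.univ.filter fun s : K (π j₁) →+* ℂ => s.comp e = ψ).map ⟨Sigma.mk j₁, sigma_mk_injective⟩ with hT
  have hj : j₁ ≠ j₀ := fun h => slot_ne_of_finrank π h2 h6 (congrArg π h)
  have hx₀T : (⟨j₀, ψ₀⟩ : (j : Fin N) × (K (π j) →+* ℂ)) ∉ T := by
    intro hx
    rw [hT, Finset.mem_map] at hx
    obtain ⟨s, -, hs⟩ := hx
    exact hj (Sigma.mk.inj_iff.1 hs).1
  have hcardT : T.card = 3 := by
    rw [hT, Finset.card_map, WeilFibre.card_fibre_eq_three (Φ (π j₀)) h2 h6 e ψ]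
  have hCM : IsCMTypeWith (starRingAut : ℂ ≃+* ℂ) (Φ (π j₀)).1 := isCMTypeWith_conj (Φ (π j₀))
  have hc : Fintype.card (K (π j₀) →+* ℂ) = 2 := by rw [Embeddings.card, h2]
  refine ⟨by rw [Finset.card_insert_of_notMem hx₀T, hcardT], ?_⟩
  refine (CMAlgebra.isGaloisBalancedAlg_slots_iff_two_mul Φ π _).2 fun τ => ?_
  rw [Finset.card_insert_of_notMem hx₀T, hcardT]
  -- the count as a filtered finset
  have hset : {x : (j : Fin N) × (K (π j) →+* ℂ) | x ∈ insert (⟨j₀, ψ₀⟩ : (j : Fin N) × (K (π j) →+* ℂ)) T ∧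
        (τ : ℂ →+* ℂ).comp x.2 ∈ (Φ (π x.1)).1} =
      ↑((insert (⟨j₀, ψ₀⟩ : (j : Fin N) × (K (π j) →+* ℂ)) T).filter fun x => (τ : ℂ →+* ℂ).comp x.2 ∈ (Φ (π x.1)).1) := by
    ext x
    simp only [Set.mem_setOf_eq, Finset.coe_filter]
  rw [hset, Set.ncard_coe_finset, Finset.filter_insert]
  -- the threefold part of the count: `n(τ ∘ ψ)`
  have hTcount : (T.filter fun x => (τ : ℂ →+* ℂ).comp x.2 ∈ (Φ (π x.1)).1).card =
      (Finset.univ.filter fun s : K (π j₁) →+* ℂ => s.comp e = (τ : ℂ →+* ℂ).comp ψ ∧ s ∈ (Φ (π j₁)).1).card := by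
    rw [hT, Finset.filter_map, Finset.card_map, Finset.filter_filter]
    exact WeilFibre.card_fibre_comp_mem_eq e (Φ (π j₁)) ψ τ
  have hx₀T' : (⟨j₀, ψ₀⟩ : (j : Fin N) × (K (π j) →+* ℂ)) ∉
      T.filter fun x => (τ : ℂ →+* ℂ).comp x.2 ∈ (Φ (π x.1)).1 := fun h => hx₀T (Finset.mem_filter.1 h).1
  have hsum := WeilFibre.card_fibre_mem_add (Φ (π j₀)) h2 h6 e (Φ (π j₁)) ψ
  rcases TwoSlot.forall_smul_eq_or_forall_smul_eq_rho_smul (G := ℂ ≃+* ℂ) (E := fun i => K i →+* ℂ)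
    (Φ := fun i => (Φ i).1) (i := π j₀) hCM hc τ with hfix | hrho
  · -- `τ` fixes `Hom(k, ℂ)`
    have h1 : (τ : ℂ →+* ℂ).comp ψ₀ = ψ₀ := hfix ψ₀
    have h2' : (τ : ℂ →+* ℂ).comp ψ = ψ := hfix ψ
    simp only [h1, hψ₀, if_true]
    rw [Finset.card_insert_of_notMem hx₀T', hTcount, h2', hn]
  · -- `τ` is complex conjugation on `Hom(k, ℂ)`
    have h1 : (τ : ℂ →+* ℂ).comp ψ₀ = conjugate ψ₀ := by rw [← conj_smul_eq_conjugate]; exact hrho ψ₀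
    have h2' : (τ : ℂ →+* ℂ).comp ψ = conjugate ψ := by rw [← conj_smul_eq_conjugate]; exact hrho ψ
    have hnot : conjugate ψ₀ ∉ (Φ (π j₀)).1 := ((Φ (π j₀)).2 ψ₀).1 hψ₀
    simp only [h1, hnot, if_false]
    rw [hTcount, h2']
    omega

/-- **The Weil fibre weight is not a disjoint union of balanced pairs**: for a SEPARATING family the multiplicity
function of a member of `pohlmannDivisorSetsAlg` is conjugation invariant (the tree's
`famMult_conj_of_mem_pohlmannDivisorSetsAlg`), but `S` has multiplicity `1` at `(π j₀, ψ₀)` and `0` at `(π j₀, ψ̄₀)`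
(no other slot of `S` lies over the curve's field, of degree `2 ≠ 6`). [cite: Gordon1999HodgeAVSurvey, 9.2.2]
[cite: MoonenZarhin1999LowDim, Thm. (0.2) (1)] -/
theorem weilFibre_not_mem_pohlmannDivisorSetsAlg [Fintype I] (hsep : CMAlgebra.IsSeparatingFamily Φ) (π : Fin N → I)
    {j₀ j₁ : Fin N} (h2 : Module.finrank ℚ (K (π j₀)) = 2) (h6 : Module.finrank ℚ (K (π j₁)) = 6)
    (e : K (π j₀) →+* K (π j₁)) (ψ₀ ψ : K (π j₀) →+* ℂ) :
    insert (⟨j₀, ψ₀⟩ : (j : Fin N) × (K (π j) →+* ℂ))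
        ((Finset.univ.filter fun s : K (π j₁) →+* ℂ => s.comp e = ψ).map ⟨Sigma.mk j₁, sigma_mk_injective⟩) ∉
      pohlmannDivisorSetsAlg (K := fun j : Fin N => K (π j)) (fun j => Φ (π j)) 2 := by
  intro hU
  have h := CMAlgebra.famMult_conj_of_mem_pohlmannDivisorSetsAlg hsep π hU ⟨π j₀, ψ₀⟩
  -- multiplicity `≥ 1` at `(π j₀, ψ₀)`
  have hpos : 0 < CMAlgebra.famMult π (insert (⟨j₀, ψ₀⟩ : (j : Fin N) × (K (π j) →+* ℂ))
      ((Finset.univ.filter fun s : K (π j₁) →+* ℂ => s.comp e = ψ).map ⟨Sigma.mk j₁, sigma_mk_injective⟩))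
      ⟨π j₀, ψ₀⟩ := by
    unfold CMAlgebra.famMult
    exact Finset.card_pos.2 ⟨⟨j₀, ψ₀⟩, Finset.mem_filter.2 ⟨Finset.mem_insert_self _ _, rfl⟩⟩
  -- multiplicity `0` at `(π j₀, ψ̄₀)`
  have hzero : CMAlgebra.famMult π (insert (⟨j₀, ψ₀⟩ : (j : Fin N) × (K (π j) →+* ℂ))
      ((Finset.univ.filter fun s : K (π j₁) →+* ℂ => s.comp e = ψ).map ⟨Sigma.mk j₁, sigma_mk_injective⟩))
      ⟨π j₀, conjugate ψ₀⟩ = 0 := by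
    unfold CMAlgebra.famMult
    refine Finset.card_eq_zero.2 (Finset.filter_eq_empty_iff.2 fun x hx hxy => ?_)
    rcases Finset.mem_insert.1 hx with rfl | hx
    · rw [CMAlgebra.slotProj_apply] at hxy
      exact conjugate_ne_self (Φ (π j₀)) ψ₀ (eq_of_heq (Sigma.mk.inj_iff.1 hxy).2).symm
    · obtain ⟨s, -, rfl⟩ := Finset.mem_map.1 hx
      rw [CMAlgebra.slotProj_apply] at hxy
      exact slot_ne_of_finrank π h2 h6 (Sigma.mk.inj_iff.1 hxy).1
  rw [hzero] at h
  exact (Nat.lt_irrefl 0) (h ▸ hpos)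

/-- **An exceptional weight in degree `4` on any product with a curve slot and a threefold slot linked by `k ↪ K`.**
[cite: MoonenZarhin1999LowDim, Thm. (0.2) (a) and (1)] -/
theorem exists_mem_pohlmannSetsAlg_two_diff_of_ringHom [Fintype I] (hsep : CMAlgebra.IsSeparatingFamily Φ)
    (π : Fin N → I) {j₀ j₁ : Fin N} (h2 : Module.finrank ℚ (K (π j₀)) = 2) (h6 : Module.finrank ℚ (K (π j₁)) = 6)
    (hnd : IsNondegenerate (Φ (π j₁))) (e : K (π j₀) →+* K (π j₁)) :
    (pohlmannSetsAlg (K := fun j : Fin N => K (π j)) (fun j => Φ (π j)) 2 \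
      pohlmannDivisorSetsAlg (K := fun j : Fin N => K (π j)) (fun j => Φ (π j)) 2).Nonempty := by
  have hCM : IsCMTypeWith (starRingAut : ℂ ≃+* ℂ) (Φ (π j₀)).1 := isCMTypeWith_conj (Φ (π j₀))
  have hc : Fintype.card (K (π j₀) →+* ℂ) = 2 := by rw [Embeddings.card, h2]
  obtain ⟨ψ₀, hψ₀⟩ := TwoSlot.exists_mem (G := ℂ ≃+* ℂ) (E := fun i => K i →+* ℂ) (Φ := fun i => (Φ i).1)
    (i := π j₀) hCM hc
  obtain ⟨ψ, -, hn⟩ := WeilFibre.exists_card_fibre_mem_eq_one (Φ (π j₀)) h2 h6 e hnd ψ₀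
  exact ⟨_, weilFibre_mem_pohlmannSetsAlg_two π h2 h6 e hψ₀ hn, weilFibre_not_mem_pohlmannDivisorSetsAlg hsep π h2 h6 e ψ₀ ψ⟩

end Weight

/-! ## §3 Exceptional `(2,2)`-classes on `E × T` and on every product containing both -/

section Geometry

variable {I : Type} {K : I → Type} [∀ i, Field (K i)] [∀ i, NumberField (K i)] [∀ i, IsCMField (K i)] [Fintype I]
  {Φ : ∀ i, CMType (K i)}
variable {A : I → AbelianVariety ℂ} {ι : ∀ i, 𝓞 (K i) →+* End (A i)}
  {θ : ∀ i, K i →+* Module.End ℂ (complexBetti (A i).X 1)}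

/-- **`D² ≠ B²` on every product with a curve slot `j₀` and a threefold slot `j₁` linked by `e : K_{π j₀} ↪ K_{π j₁}`**:
for a separating family of realisations (`Φ_{π j₁}` nondegenerate, e.g. a simple CM threefold), `⨁_{j<N} A_{π j}` carries
a rational `(2,2)`-class OUTSIDE `D² ⊗ ℂ` — the Weil classes of `k` on `E × T`, pulled back.
[cite: MoonenZarhin1999LowDim, Thm. (0.2) (a) and (1)] [cite: Gordon1999HodgeAVSurvey, 9.2.2] -/
theorem exists_exceptional_two_prod_of_ringHom (hsep : CMAlgebra.IsSeparatingFamily Φ)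
    (hA : ∀ i, IsCMTypeRealisation (Φ i) (A i) (ι i) (θ i)) {N : ℕ} (π : Fin N → I) {j₀ j₁ : Fin N}
    (h2 : Module.finrank ℚ (K (π j₀)) = 2) (h6 : Module.finrank ℚ (K (π j₁)) = 6) (hnd : IsNondegenerate (Φ (π j₁)))
    (e : K (π j₀) →+* K (π j₁)) :
    ∃ c : complexBetti (⨁ fun j : Fin N => A (π j)).X (2 * 2), IsRationalClass c ∧
      IsOfHodgeType (⨁ fun j : Fin N => A (π j)).dim (⨁ fun j : Fin N => A (π j)).X (2 * 2) 2 2 c ∧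
      c ∉ divisorClassesSpan (⨁ fun j : Fin N => A (π j)).X (⨁ fun j : Fin N => A (π j)).dim 2 :=
  (exists_exceptional_biproduct_iff (K := fun j : Fin N => K (π j)) (A := fun j => A (π j))
    (Φ := fun j => Φ (π j)) (ι := fun j => ι (π j)) (θ := fun j => θ (π j)) (fun j => hA (π j)) 2).2
    (exists_mem_pohlmannSetsAlg_two_diff_of_ringHom hsep π h2 h6 hnd e)

end Geometry

end Literature.AlgebraicGeometry.ComplexMultiplication

end

/-! ## Part 2: PairwiseCMFamiliesHodge -/

noncomputable section

open _root_.CategoryTheory _root_.CategoryTheory.Limits NumberField NumberField.ComplexEmbedding IntermediateField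
open scoped BigOperators

/-! ## §0 Abstract pairwise conditions: eigenvectors on two-element slots and under (□) -/

namespace Literature.AlgebraicGeometry.ComplexMultiplication.PairwiseCC

open Literature.AlgebraicGeometry.ComplexMultiplication.Domination

open Literature.NumberTheory.ComplexMultiplication
open Literature.AlgebraicGeometry.ComplexMultiplication.TwoSlot

variable {G : Type*} [Group G] {I : Type*} {E : I → Type*} [∀ i, MulAction G (E i)] {ρ : G} {Φ : ∀ i, Set (E i)}

/-- On a two-element slot every element of `U(Φ_i) = ℚ u_1` is a `χ_i`-eigenvector: `f ∘ (g • ·) = χ_i(g) f`.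
[cite: MoonenZarhin1999LowDim, Cor. (3.9) (proof)] -/
theorem comp_smul_eq_slotSign_smul [∀ i, Fintype (E i)] [∀ i, DecidableEq (E i)] {i : I}
    (h : IsCMTypeWith ρ (Φ i)) (hc : Fintype.card (E i) = 2) {f : E i → ℚ} (hf : f ∈ antiSpan G (Φ i)) (g : G) :
    (fun x => f (g • x)) = slotSign G E i g • f := by
  induction hf using Submodule.span_induction with
  | mem u hu =>
    obtain ⟨k, rfl⟩ := hu
    show (fun x => antiVec (Φ i) k (g • x)) = slotSign G E i g • antiVec (Φ i) k
    rw [antiVec_comp_smul]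
    funext s
    rw [Pi.smul_apply, smul_eq_mul, antiVec_eq_slotSign_mul h hc (k * g) s, antiVec_eq_slotSign_mul h hc k s, map_mul]
    ring
  | zero => funext s; simp
  | add u v _ _ hu hv =>
    rw [smul_add, ← hu, ← hv]
    rfl
  | smul c u _ hu =>
    rw [smul_comm, ← hu]
    rfl

/-- **On a two-element slot a `χ`-eigenvector vanishes unless `χ = χ_i`** (`(χ(g) − χ_i(g)) f = 0`).
[cite: MoonenZarhin1999LowDim, Cor. (3.9) (proof)] -/
theorem eq_zero_of_eigen_of_card_eq_two [∀ i, Fintype (E i)] [∀ i, DecidableEq (E i)] {i : I}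
    (h : IsCMTypeWith ρ (Φ i)) (hc : Fintype.card (E i) = 2) (χ : G → ℚ) (hne : ∃ g : G, χ g ≠ slotSign G E i g)
    {f : E i → ℚ} (hf : f ∈ antiSpan G (Φ i)) (heig : ∀ g : G, (fun x => f (g • x)) = χ g • f) : f = 0 := by
  obtain ⟨g, hg⟩ := hne
  have h1 : (χ g - slotSign G E i g) • f = 0 := by
    rw [sub_smul, ← heig g, comp_smul_eq_slotSign_smul h hc hf g, sub_self]
  exact (smul_eq_zero.1 h1).resolve_left (sub_ne_zero.2 hg)

end Literature.AlgebraicGeometry.ComplexMultiplication.PairwiseCC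

/-! ## §1 CM fields -/

namespace Literature.AlgebraicGeometry.ComplexMultiplication

open Literature.NumberTheory.ComplexMultiplication
open Literature.AlgebraicGeometry.Motives (AbelianVariety CMType)
open Literature.AlgebraicGeometry.HodgeTheory
open Literature.AlgebraicGeometry.Pohlmann1968

section Fields

variable {I : Type} {K : I → Type} [∀ i, Field (K i)] [∀ i, NumberField (K i)] [∀ i, IsCMField (K i)] [Fintype I]
  [DecidableEq I]

omit [∀ i, IsCMField (K i)] [DecidableEq I] in
/-- `|⊔_i Hom(K_i, ℂ)| = Σ_i [K_i : ℚ]`. [cite: Gordon1999HodgeAVSurvey, §3 Theorem and 10.10] -/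
private theorem card_sigma_ringHom_eq_sum'' :
    Fintype.card ((i : I) × (K i →+* ℂ)) = ∑ i, Module.finrank ℚ (K i) := by
  rw [Fintype.card_sigma]
  exact Finset.sum_congr rfl fun i _ => Embeddings.card (K i) ℂ

/-- **The pairwise criterion for CM fields**: if for all `i ≠ j` the Galois modules `U(Φ_i) ⊆ ℚ^{Hom(K_i, ℂ)}` and
`U(Φ_j)` have no common constituent, then `(Φ_i)_i` is nondegenerate iff every `Φ_i` is — `∏_i A_{Φ_i}` is stably
nondegenerate iff every factor is. [cite: Gordon1999HodgeAVSurvey, §3 Theorem and 7.5] -/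
theorem isNondegenerateFamily_iff_forall_of_pairwise [Nonempty I] (Φ : ∀ i, CMType (K i))
    (hpair : ∀ i j, i ≠ j → ∀ P : Submodule ℚ ((K i →+* ℂ) → ℚ), P ≤ antiSpan (ℂ ≃+* ℂ) (Φ i).1 →
      (∀ g : ℂ ≃+* ℂ, ∀ f ∈ P, (fun x => f (g • x)) ∈ P) →
      ∀ T : ((K i →+* ℂ) → ℚ) →ₗ[ℚ] ((K j →+* ℂ) → ℚ),
        (∀ g : ℂ ≃+* ℂ, ∀ f ∈ P, T (fun x => f (g • x)) = fun y => T f (g • y)) →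
        (∀ f ∈ P, T f ∈ antiSpan (ℂ ≃+* ℂ) (Φ j).1) → (∀ f ∈ P, T f = 0 → f = 0) → P = ⊥) :
    CMAlgebra.IsNondegenerateFamily Φ ↔ ∀ i, IsNondegenerate (Φ i) := by
  have key := typeRank_sigmaType_eq_iff_forall_of_pairwise (G := ℂ ≃+* ℂ) (Φ := fun i => (Φ i).1)
    (fun i => isCMTypeWith_conj (Φ i)) hpair
  rw [CMAlgebra.isNondegenerateFamily_iff, ← card_sigma_ringHom_eq_sum'' (K := K)]
  refine key.trans (forall_congr' fun i => ?_)
  rw [isNondegenerate_iff, cmTypeRank, ← Embeddings.card (K i) ℂ]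

omit [Fintype I] [DecidableEq I] in
/-- **Different sign characters from a separating quadratic sub-family**: for distinct quadratic slots `i, j` some
automorphism of `ℂ` fixes the embeddings of one of `K_i, K_j` but not of the other (Kubota separation of the quadratic
part; pairwise non-isogenous CM elliptic curves). [cite: Kubota1965, §2 (p. 115)] -/
theorem exists_not_iff_of_isSeparatingFamily (p : I → Prop) (Φ : ∀ i, CMType (K i))
    (h2 : ∀ j, ¬p j → Module.finrank ℚ (K j) = 2)
    (hsep : CMAlgebra.IsSeparatingFamily (fun j : {j // ¬p j} => Φ j.1)) :
    ∀ i j, ¬p i → ¬p j → i ≠ j → ∃ g : ℂ ≃+* ℂ,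
      ¬((∀ s : K i →+* ℂ, g • s = s) ↔ ∀ s : K j →+* ℂ, g • s = s) := by
  classical
  intro i j hi hj hij
  have hCM : ∀ j : {j // ¬p j}, IsCMTypeWith (starRingAut : ℂ ≃+* ℂ) (Φ j.1).1 := fun j => isCMTypeWith_conj (Φ j.1)
  have hc : ∀ j : {j // ¬p j}, Fintype.card (K j.1 →+* ℂ) = 2 := fun j => by rw [Embeddings.card, h2 j.1 j.2]
  have hinj := TwoSlot.slotSign_injective_of_separating (G := ℂ ≃+* ℂ) (E := fun j : {j // ¬p j} => K j.1 →+* ℂ)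
    (Φ := fun j : {j // ¬p j} => (Φ j.1).1) hCM hc ((CMAlgebra.isSeparatingFamily_iff_smul _).1 hsep)
  by_contra hall
  have hall' : ∀ g : ℂ ≃+* ℂ, (∀ s : K i →+* ℂ, g • s = s) ↔ ∀ s : K j →+* ℂ, g • s = s :=
    fun g => not_not.1 fun hg => hall ⟨g, hg⟩
  have heq : TwoSlot.slotSign (ℂ ≃+* ℂ) (fun j : {j // ¬p j} => K j.1 →+* ℂ) ⟨i, hi⟩ =
      TwoSlot.slotSign (ℂ ≃+* ℂ) (fun j : {j // ¬p j} => K j.1 →+* ℂ) ⟨j, hj⟩ := by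
    refine MonoidHom.ext fun g => ?_
    rcases TwoSlot.forall_smul_eq_or_forall_smul_eq_rho_smul (G := ℂ ≃+* ℂ) (E := fun j : {j // ¬p j} => K j.1 →+* ℂ)
      (Φ := fun j : {j // ¬p j} => (Φ j.1).1) (i := ⟨i, hi⟩) (hCM ⟨i, hi⟩) (hc ⟨i, hi⟩) g with hgi | hgi
    · have hgj : ∀ s : K j →+* ℂ, g • s = s := (hall' g).1 hgi
      rw [TwoSlot.slotSign_of_forall_smul_eq (G := ℂ ≃+* ℂ) (E := fun j : {j // ¬p j} => K j.1 →+* ℂ) (i := ⟨i, hi⟩) hgi,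
        TwoSlot.slotSign_of_forall_smul_eq (G := ℂ ≃+* ℂ) (E := fun j : {j // ¬p j} => K j.1 →+* ℂ) (i := ⟨j, hj⟩) hgj]
    · rcases TwoSlot.forall_smul_eq_or_forall_smul_eq_rho_smul (G := ℂ ≃+* ℂ) (E := fun j : {j // ¬p j} => K j.1 →+* ℂ)
        (Φ := fun j : {j // ¬p j} => (Φ j.1).1) (i := ⟨j, hj⟩) (hCM ⟨j, hj⟩) (hc ⟨j, hj⟩) g with hgj | hgj
      · have hgi' : ∀ s : K i →+* ℂ, g • s = s := (hall' g).2 hgj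
        rw [TwoSlot.slotSign_of_forall_smul_eq (G := ℂ ≃+* ℂ) (E := fun j : {j // ¬p j} => K j.1 →+* ℂ) (i := ⟨i, hi⟩)
            hgi',
          TwoSlot.slotSign_of_forall_smul_eq (G := ℂ ≃+* ℂ) (E := fun j : {j // ¬p j} => K j.1 →+* ℂ) (i := ⟨j, hj⟩) hgj]
      · rw [TwoSlot.slotSign_of_forall_smul_eq_rho_smul (G := ℂ ≃+* ℂ) (E := fun j : {j // ¬p j} => K j.1 →+* ℂ)
            (Φ := fun j : {j // ¬p j} => (Φ j.1).1) (i := ⟨i, hi⟩) (hCM ⟨i, hi⟩) (hc ⟨i, hi⟩) hgi,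
          TwoSlot.slotSign_of_forall_smul_eq_rho_smul (G := ℂ ≃+* ℂ) (E := fun j : {j // ¬p j} => K j.1 →+* ℂ)
            (Φ := fun j : {j // ¬p j} => (Φ j.1).1) (i := ⟨j, hj⟩) (hCM ⟨j, hj⟩) (hc ⟨j, hj⟩) hgj]
  exact hij (congrArg Subtype.val (hinj heq))

end Fields

end Literature.AlgebraicGeometry.ComplexMultiplication

end

/-! ## Part 3: ForeignQuadraticCMFieldsHodge -/

noncomputable section

open _root_.CategoryTheory _root_.CategoryTheory.Limits NumberField NumberField.ComplexEmbedding IntermediateField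
open scoped BigOperators

namespace Literature.AlgebraicGeometry.ComplexMultiplication

open Literature.AlgebraicGeometry.ComplexMultiplication.Domination

open Literature.NumberTheory.ComplexMultiplication
open Literature.AlgebraicGeometry.Motives (AbelianVariety CMType)
open Literature.AlgebraicGeometry.HodgeTheory
open Literature.AlgebraicGeometry.Pohlmann1968

/-! ## §0 A foreign imaginary quadratic slot has no common constituent with the slot it is foreign to -/

section Fields

variable {I : Type} {K : I → Type} [∀ i, Field (K i)] [∀ i, NumberField (K i)] [∀ i, IsCMField (K i)]

omit [∀ i, IsCMField (K i)] in
/-- **No `χ`-eigenvector on `ℚ^{Hom(K_b, ℂ)}` for a character of a FOREIGN quadratic slot**: if `[K_a : ℚ] = 2`, `K_a` does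
not embed in `K_b`, `χ(τ) = 1` whenever `τ` fixes every embedding of `K_a`, and `χ(ρ) ≠ 1` for complex conjugation `ρ`,
then every `f : Hom(K_b, ℂ) → ℚ` with `f ∘ g = χ(g) f` vanishes (the stabiliser of `Hom(K_a, ℂ)` acts transitively on
`Hom(K_b, ℂ)`, so `f` is constant). [cite: MoonenZarhin1999LowDim, Thm. (0.2) (4) and Cor. (3.9)] -/
theorem PairwiseCC.eq_zero_of_eigen_of_isEmpty {a b : I} (h2 : Module.finrank ℚ (K a) = 2)
    (he : IsEmpty (K a →+* K b)) (χ : (ℂ ≃+* ℂ) → ℚ) (hχ1 : ∀ τ : ℂ ≃+* ℂ, (∀ u : K a →+* ℂ, τ • u = u) → χ τ = 1)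
    (hχρ : χ (starRingAut : ℂ ≃+* ℂ) ≠ 1) {f : (K b →+* ℂ) → ℚ}
    (heig : ∀ g : ℂ ≃+* ℂ, (fun x => f (g • x)) = χ g • f) : f = 0 :=
  eq_zero_of_eigen_of_transitive χ heig
    (fun x y => by
      obtain ⟨τ, hτu, hτx⟩ := exists_ringEquiv_smul_eq_of_isEmpty h2 he x y
      exact ⟨τ, hχ1 τ hτu, hτx⟩)
    hχρ

/-- **A foreign imaginary quadratic slot has no common constituent with the slot it is foreign to** (both orders): for
`[K_a : ℚ] = 2` and `IsEmpty (K a →+* K b)`, no non-zero `Aut(ℂ)`-stable `P ≤ U(Φ_a)` maps equivariantly and injectively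
into `U(Φ_b)`, nor vice versa — `U(Φ_a) = ℚ u` is `χ_a`-isotypic and `ℚ^{Hom(K_b, ℂ)}` has no `χ_a`-eigenvector.
[cite: MoonenZarhin1999LowDim, Thm. (0.2) (4) and Cor. (3.9)] [cite: Gordon1999HodgeAVSurvey, §3 Theorem (proof)] -/
theorem pairwise_of_isEmpty (Φ : ∀ i, CMType (K i)) {a b : I} (h2 : Module.finrank ℚ (K a) = 2)
    (he : IsEmpty (K a →+* K b)) :
    (∀ P : Submodule ℚ ((K a →+* ℂ) → ℚ), P ≤ antiSpan (ℂ ≃+* ℂ) (Φ a).1 →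
      (∀ g : ℂ ≃+* ℂ, ∀ f ∈ P, (fun x => f (g • x)) ∈ P) →
      ∀ T : ((K a →+* ℂ) → ℚ) →ₗ[ℚ] ((K b →+* ℂ) → ℚ),
        (∀ g : ℂ ≃+* ℂ, ∀ f ∈ P, T (fun x => f (g • x)) = fun y => T f (g • y)) →
        (∀ f ∈ P, T f ∈ antiSpan (ℂ ≃+* ℂ) (Φ b).1) → (∀ f ∈ P, T f = 0 → f = 0) → P = ⊥) ∧
    (∀ P : Submodule ℚ ((K b →+* ℂ) → ℚ), P ≤ antiSpan (ℂ ≃+* ℂ) (Φ b).1 →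
      (∀ g : ℂ ≃+* ℂ, ∀ f ∈ P, (fun x => f (g • x)) ∈ P) →
      ∀ T : ((K b →+* ℂ) → ℚ) →ₗ[ℚ] ((K a →+* ℂ) → ℚ),
        (∀ g : ℂ ≃+* ℂ, ∀ f ∈ P, T (fun x => f (g • x)) = fun y => T f (g • y)) →
        (∀ f ∈ P, T f ∈ antiSpan (ℂ ≃+* ℂ) (Φ a).1) → (∀ f ∈ P, T f = 0 → f = 0) → P = ⊥) := by
  classical
  have hCM : IsCMTypeWith (starRingAut : ℂ ≃+* ℂ) (Φ a).1 := isCMTypeWith_conj (Φ a)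
  have hc : Fintype.card (K a →+* ℂ) = 2 := by rw [Embeddings.card, h2]
  have hquad : ∀ f ∈ antiSpan (ℂ ≃+* ℂ) (Φ a).1, ∀ g : ℂ ≃+* ℂ,
      (fun x => f (g • x)) = TwoSlot.slotSign (ℂ ≃+* ℂ) (fun i => K i →+* ℂ) a g • f := fun f hf g =>
    PairwiseCC.comp_smul_eq_slotSign_smul (Φ := fun i => (Φ i).1) hCM hc hf g
  have hρ : TwoSlot.slotSign (ℂ ≃+* ℂ) (fun i => K i →+* ℂ) a (starRingAut : ℂ ≃+* ℂ) ≠ 1 := by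
    rw [TwoSlot.slotSign_of_forall_smul_eq_rho_smul (Φ := fun i => (Φ i).1) hCM hc (g := starRingAut) fun s => rfl]
    norm_num
  have hzero : ∀ f ∈ antiSpan (ℂ ≃+* ℂ) (Φ b).1,
      (∀ g : ℂ ≃+* ℂ, (fun x => f (g • x)) = TwoSlot.slotSign (ℂ ≃+* ℂ) (fun i => K i →+* ℂ) a g • f) → f = 0 :=
    fun f _ heig => PairwiseCC.eq_zero_of_eigen_of_isEmpty h2 he
      (TwoSlot.slotSign (ℂ ≃+* ℂ) (fun i => K i →+* ℂ) a) (fun τ hτ => TwoSlot.slotSign_of_forall_smul_eq hτ) hρ heig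
  exact pairwise_of_eigenvector (G := ℂ ≃+* ℂ) (Φ := fun i => (Φ i).1) (i := a) (j := b)
    (TwoSlot.slotSign (ℂ ≃+* ℂ) (fun i => K i →+* ℂ) a) hquad hzero

/-- **(□) forces foreignness**: if `[K_a : ℚ] = 2` and some `τ ∈ Aut(ℂ)` satisfies `τ ∘ τ ∘ s = s̄` for all
`s : K_b → ℂ`, then `K_a` does not embed in `K_b` (`τ²` is the identity on the two embeddings of `K_a`, but conjugation
on `s ∘ j`). [cite: Gordon1999HodgeAVSurvey, §3 Theorem (proof)] -/
theorem isEmpty_ringHom_of_smul_smul (Φ : ∀ i, CMType (K i)) {a b : I} (h2 : Module.finrank ℚ (K a) = 2)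
    (hτ : ∃ τ : ℂ ≃+* ℂ, ∀ s : K b →+* ℂ, τ • τ • s = conjugate s) : IsEmpty (K a →+* K b) := by
  classical
  obtain ⟨τ, hτ⟩ := hτ
  have hCM : IsCMTypeWith (starRingAut : ℂ ≃+* ℂ) (Φ a).1 := isCMTypeWith_conj (Φ a)
  have hc : Fintype.card (K a →+* ℂ) = 2 := by rw [Embeddings.card, h2]
  refine ⟨fun j => ?_⟩
  obtain ⟨s⟩ : Nonempty (K b →+* ℂ) := inferInstance
  -- `τ ∘ τ` is the identity on the two-element slot `Hom(K_a, ℂ)`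
  have hsq : ∀ u : K a →+* ℂ, τ • τ • u = u := by
    intro u
    rcases TwoSlot.forall_smul_eq_or_forall_smul_eq_rho_smul (G := ℂ ≃+* ℂ) (E := fun i => K i →+* ℂ)
      (Φ := fun i => (Φ i).1) (i := a) hCM hc τ with hfix | hrho
    · rw [hfix u, hfix u]
    · rw [hrho u, hCM.comm, hrho u, hCM.invol]
  have h1 : τ • τ • (s.comp j) = (τ • τ • s).comp j := rfl
  have hreal : ComplexEmbedding.IsReal (s.comp j) := by
    rw [ComplexEmbedding.isReal_iff]
    have h := hsq (s.comp j)
    rw [h1, hτ s] at h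
    -- `h : (conjugate s).comp j = s.comp j`
    exact h
  exact IsTotallyComplex.complexEmbedding_not_isReal (s.comp j) hreal

/-! ## §1 The third menu and the exact criterion -/

/-- **The third menu.**  The pairwise criterion holds for a family whose slots off `B = {i | p i}` are imaginary
quadratic and pairwise distinguished by some automorphism of `ℂ`, EVERY quadratic slot being FOREIGN to every `K_b`,
`b ∈ B` (`IsEmpty (K a →+* K b)`), and whose pairs inside `B` carry pairwise partial conjugations.  Contains the
curve–big clauses of the first menu ((□)) and of the second (partial conjugations), both of which imply foreignness.
[cite: MoonenZarhin1999LowDim, Thm. (0.2) (4)] [cite: Gordon1999HodgeAVSurvey, §3 Theorem (proof)] -/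
theorem pairwise_of_menu₃ (p : I → Prop) (Φ : ∀ i, CMType (K i))
    (h2 : ∀ j, ¬p j → Module.finrank ℚ (K j) = 2)
    (hχ : ∀ i j, ¬p i → ¬p j → i ≠ j → ∃ g : ℂ ≃+* ℂ,
      ¬((∀ s : K i →+* ℂ, g • s = s) ↔ ∀ s : K j →+* ℂ, g • s = s))
    (hfor : ∀ a b, ¬p a → p b → IsEmpty (K a →+* K b))
    (hbb : ∀ a b, p a → p b → a ≠ b →
      ∃ σ : ℂ ≃+* ℂ, (∀ s : K a →+* ℂ, σ • s = conjugate s) ∧ ∀ s : K b →+* ℂ, σ • s = s) :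
    ∀ i j, i ≠ j → ∀ P : Submodule ℚ ((K i →+* ℂ) → ℚ), P ≤ antiSpan (ℂ ≃+* ℂ) (Φ i).1 →
      (∀ g : ℂ ≃+* ℂ, ∀ f ∈ P, (fun x => f (g • x)) ∈ P) →
      ∀ T : ((K i →+* ℂ) → ℚ) →ₗ[ℚ] ((K j →+* ℂ) → ℚ),
        (∀ g : ℂ ≃+* ℂ, ∀ f ∈ P, T (fun x => f (g • x)) = fun y => T f (g • y)) →
        (∀ f ∈ P, T f ∈ antiSpan (ℂ ≃+* ℂ) (Φ j).1) → (∀ f ∈ P, T f = 0 → f = 0) → P = ⊥ := by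
  classical
  have hCM : ∀ i, IsCMTypeWith (starRingAut : ℂ ≃+* ℂ) (Φ i).1 := fun i => isCMTypeWith_conj (Φ i)
  have hc : ∀ j, ¬p j → Fintype.card (K j →+* ℂ) = 2 := fun j hj => by rw [Embeddings.card, h2 j hj]
  intro i j hij
  by_cases hi : p i <;> by_cases hj : p j
  · -- two big slots: a pairwise partial conjugation
    obtain ⟨σ, hσa, hσb⟩ := hbb i j hi hj hij
    exact (pairwise_of_partialConj (G := ℂ ≃+* ℂ) (Φ := fun i => (Φ i).1) hCM (i := i) (j := j) (σ := σ)
      (fun s => by rw [hσa s, conj_smul_eq_conjugate]) hσb).1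
  · -- `i` big, `j` quadratic and foreign to `K_i`
    exact (pairwise_of_isEmpty Φ (h2 j hj) (hfor j i hj hi)).2
  · -- `i` quadratic and foreign to `K_j`, `j` big
    exact (pairwise_of_isEmpty Φ (h2 i hi) (hfor i j hi hj)).1
  · -- two quadratic slots with different sign characters
    have hquad : ∀ j, ¬p j → ∀ f ∈ antiSpan (ℂ ≃+* ℂ) (Φ j).1, ∀ g : ℂ ≃+* ℂ,
        (fun x => f (g • x)) = TwoSlot.slotSign (ℂ ≃+* ℂ) (fun i => K i →+* ℂ) j g • f := fun j hj f hf g =>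
      PairwiseCC.comp_smul_eq_slotSign_smul (Φ := fun i => (Φ i).1) (hCM j) (hc j hj) hf g
    have hne : ∃ g : ℂ ≃+* ℂ,
        TwoSlot.slotSign (ℂ ≃+* ℂ) (fun i => K i →+* ℂ) i g ≠ TwoSlot.slotSign (ℂ ≃+* ℂ) (fun i => K i →+* ℂ) j g := by
      obtain ⟨g, hg⟩ := hχ i j hi hj hij
      refine ⟨g, fun heq => hg ?_⟩
      rw [TwoSlot.forall_smul_eq_iff_slotSign_eq_one (G := ℂ ≃+* ℂ) (E := fun i => K i →+* ℂ)
          (Φ := fun i => (Φ i).1) (hCM i) (hc i hi) g,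
        TwoSlot.forall_smul_eq_iff_slotSign_eq_one (G := ℂ ≃+* ℂ) (E := fun i => K i →+* ℂ)
          (Φ := fun i => (Φ i).1) (hCM j) (hc j hj) g, heq]
    exact (pairwise_of_eigenvector (G := ℂ ≃+* ℂ) (Φ := fun i => (Φ i).1) (i := i) (j := j)
      (TwoSlot.slotSign (ℂ ≃+* ℂ) (fun i => K i →+* ℂ) i) (hquad i hi) fun f hf heig =>
        PairwiseCC.eq_zero_of_eigen_of_card_eq_two (Φ := fun i => (Φ i).1) (hCM j) (hc j hj) _ hne hf heig).1

variable [Fintype I] [DecidableEq I] [Nonempty I]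

/-- **Nondegeneracy from the third menu**: the family is nondegenerate iff every non-quadratic member is.
[cite: MoonenZarhin1999LowDim, Thm. (0.2) (4)] [cite: Gordon1999HodgeAVSurvey, §3 Theorem and 7.5] -/
theorem isNondegenerateFamily_iff_of_menu₃ (p : I → Prop) (Φ : ∀ i, CMType (K i))
    (h2 : ∀ j, ¬p j → Module.finrank ℚ (K j) = 2)
    (hχ : ∀ i j, ¬p i → ¬p j → i ≠ j → ∃ g : ℂ ≃+* ℂ,
      ¬((∀ s : K i →+* ℂ, g • s = s) ↔ ∀ s : K j →+* ℂ, g • s = s))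
    (hfor : ∀ a b, ¬p a → p b → IsEmpty (K a →+* K b))
    (hbb : ∀ a b, p a → p b → a ≠ b →
      ∃ σ : ℂ ≃+* ℂ, (∀ s : K a →+* ℂ, σ • s = conjugate s) ∧ ∀ s : K b →+* ℂ, σ • s = s) :
    CMAlgebra.IsNondegenerateFamily Φ ↔ ∀ b, p b → IsNondegenerate (Φ b) := by
  rw [isNondegenerateFamily_iff_forall_of_pairwise Φ (pairwise_of_menu₃ p Φ h2 hχ hfor hbb)]
  refine ⟨fun H b _ => H b, fun H i => ?_⟩
  by_cases hi : p i
  · exact H i hi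
  · exact isNondegenerate_of_finrank_eq_two (Φ i) (h2 i hi)

omit [∀ i, NumberField (K i)] [∀ i, IsCMField (K i)] [Fintype I] [DecidableEq I] [Nonempty I] in
/-- A sub-family of a separating family is separating (Kubota separation restricts to subsets of slots).
[cite: Kubota1965, §2 (p. 115)] -/
theorem isSeparatingFamily_subtype {Φ : ∀ i, CMType (K i)} (hsep : CMAlgebra.IsSeparatingFamily Φ) (q : I → Prop) :
    CMAlgebra.IsSeparatingFamily (fun j : {j // q j} => Φ j.1) := by
  intro x y h
  obtain ⟨h1, h2⟩ := Sigma.mk.inj_iff.1 (hsep ⟨x.1.1, x.2⟩ ⟨y.1.1, y.2⟩ h)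
  exact Sigma.ext (Subtype.ext h1) h2

/-- **The exact criterion: a shared imaginary quadratic field is the only obstruction.**  For a family with imaginary
quadratic slots off `B`, pairwise distinguished, and pairwise partial conjugations inside `B`:
`(Φ_i)_i` is nondegenerate iff every `Φ_b` (`b ∈ B`) is nondegenerate AND no quadratic field `K_a` embeds in a `K_b`
(⟸: the third menu; ⟹: members of nondegenerate families are nondegenerate, and a quadratic field shared by two slots
makes every family degenerate — seat b23's `not_isNondegenerateFamily_of_shared_imaginary_quadratic`).  In Moonen–Zarhin's
words for `X₁ × X₂`: exceptional classes iff `k ↪ End⁰(X₂)`. [cite: MoonenZarhin1999LowDim, Thm. (0.2) (a) and (4)]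
[cite: Gordon1999HodgeAVSurvey, 7.5–7.7] -/
theorem isNondegenerateFamily_iff_forall_isEmpty (p : I → Prop) (Φ : ∀ i, CMType (K i))
    (h2 : ∀ j, ¬p j → Module.finrank ℚ (K j) = 2)
    (hχ : ∀ i j, ¬p i → ¬p j → i ≠ j → ∃ g : ℂ ≃+* ℂ,
      ¬((∀ s : K i →+* ℂ, g • s = s) ↔ ∀ s : K j →+* ℂ, g • s = s))
    (hbb : ∀ a b, p a → p b → a ≠ b →
      ∃ σ : ℂ ≃+* ℂ, (∀ s : K a →+* ℂ, σ • s = conjugate s) ∧ ∀ s : K b →+* ℂ, σ • s = s) :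
    CMAlgebra.IsNondegenerateFamily Φ ↔
      (∀ b, p b → IsNondegenerate (Φ b)) ∧ ∀ a b, ¬p a → p b → IsEmpty (K a →+* K b) := by
  refine ⟨fun H => ⟨fun b _ => H.isNondegenerate b, fun a b ha hb => ⟨fun j => ?_⟩⟩,
    fun H => (isNondegenerateFamily_iff_of_menu₃ p Φ h2 hχ H.2 hbb).2 H.1⟩
  have hab : a ≠ b := fun h => ha (h ▸ hb)
  exact not_isNondegenerateFamily_of_shared_imaginary_quadratic (k := K a) (h2 a ha) hab (RingHom.id (K a)) j Φ H

/-- **Two kinds only — curves and ONE more CM field.**  For a family all of whose slots but `b` are imaginary quadratic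
and pairwise distinguished: nondegenerate iff `Φ_b` is nondegenerate and no `K_a` (`a ≠ b`) embeds in `K_b`.
[cite: MoonenZarhin1999LowDim, Thm. (0.2) (a) and (4)] -/
theorem isNondegenerateFamily_iff_forall_isEmpty_single (b : I) (Φ : ∀ i, CMType (K i))
    (h2 : ∀ j, j ≠ b → Module.finrank ℚ (K j) = 2)
    (hχ : ∀ i j, i ≠ b → j ≠ b → i ≠ j → ∃ g : ℂ ≃+* ℂ,
      ¬((∀ s : K i →+* ℂ, g • s = s) ↔ ∀ s : K j →+* ℂ, g • s = s)) :
    CMAlgebra.IsNondegenerateFamily Φ ↔ IsNondegenerate (Φ b) ∧ ∀ a, a ≠ b → IsEmpty (K a →+* K b) := by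
  rw [isNondegenerateFamily_iff_forall_isEmpty (fun i => i = b) Φ (fun j hj => h2 j hj)
    (fun i j hi hj hij => hχ i j hi hj hij) (fun a c ha hc hac => (hac (ha.trans hc.symm)).elim)]
  refine ⟨fun H => ⟨H.1 b rfl, fun a ha => H.2 a b ha rfl⟩, fun H => ⟨?_, ?_⟩⟩
  · rintro c rfl; exact H.1
  · rintro a c ha rfl; exact H.2 a ha

end Fields

end Literature.AlgebraicGeometry.ComplexMultiplication

end
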